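import Literature.MathematicalPhysics.QuantumFieldTheory.Balaban1983to89.B8Prop7TowerAxialZd3
import Literature.MathematicalPhysics.QuantumFieldTheory.Balaban1983to89.B8Ineq172Concrete

/-!
# `Balaban1983to89.B8Prop7TowerAxialUnitary` — [Balaban1985RegularSpaces] **PROPOSITION 7** (Sect. G, p. 100, (1.144)–(1.145)) **FOR PRINT'S
# TOWER-WISE AXIAL GAUGE MAP AT EVERY LAW MEMBER** of NODE 00's carrier `zdGF3` with `Ω₀ = ℤᵈ`: the map `uTower` of `B8Prop7TowerAxialZd3` is
# `U(𝔸)`-valued and within `200d·α₂` of `1` under (1.139)–(1.140) (lit-balaban r05 g7's `glev_mem_unitaryUnits` ∕ `norm_glev_sub_one_le` LOCALISED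
# to one tower by [3]'s locality, `B7Prop1Local.clampCfg` + `B8Ineq172Concrete.glev_congr_tower`); hence (1.144) in full, and (1.145) in the
# carrier's box form with the audit's repaired constant `530d` — the latter in the sequel `B8Prop7TowerAxialIneq145` (§5–§6 of this programme),
# which concludes **`B8Ineq145.Prop7RepairedC (530·d) (zdGF3 ∘ e) (toAxialTower ∘ e)`** for every index map into the law members

statement-level skeleton of published theorems with citation tags; proofs where landed; nothing here is a claim about the Yang–Mills mass gap

T. Bałaban, *Spaces of regular gauge field configurations on a lattice and gauge fixing conditions*, Commun. Math. Phys. **99** (1985) 75–102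
`[Balaban1985RegularSpaces]` ("B8"; journal page = PDF page + 74): Prop. 7 (1.144) p. 100, (1.139)–(1.141) p. 100, (1.19) p. 79, (1.5)–(1.6)
p. 77.  [3] = T. Bałaban, *Averaging operations for lattice gauge theories*, Commun. Math. Phys. **98** (1985) 17–51 `[Balaban1985Averaging]`:
(52)–(54) p. 26, (76)–(77) pp. 29–30, (87) p. 31, p. 24 («this definition is local»).

## THE PRINTED TEXT (p. 100 [PDF 26], verbatim)

*"From (1.139), (1.140) we get (U₁U₀)^u ∈ 𝔄_k({Ω_j}, α₀ + 3α₂) for arbitrary gauge transformation u, especially |(U₁U₀)^u(∂p) − 1| <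
(α₀ + 3α₂)L^{−2j} η² for p ⊂ Ω_j, (1.141) hence for α₀, α₂ sufficiently small we can apply the results of [3].  … Let us take a gauge
transformation u satisfying the conditions (1.29) and such that the configuration U′ = (U₁U₀)^u U₀⁻¹ satisfies the axial gauge conditions
(1.19).  This gauge transformation is determined uniquely."* — p. 81: *"In [3] we have determined the gauge transformation u in terms of the
configuration U₁."*; [3] p. 24: *"this definition is local … depends only on the bond variables U_b for b ⊂ B^k(c₋) ∪ B^k(c₊)."*

## WHY THIS FILE (cell `pub-ymgap`, HUMAN RULING D-0062; R134 seat `pub-ymgap-dag-n05-c` g6, DAG node N05 = [B8]; count-neutral)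

Bricks 2 + 3 of the honest `p7` (this seat's P7 SPECIES NOTE, 2026-08-27; brick 1 = `B8Prop7TowerAxialZd3`, p515888).  After the [B8″H] pin and
dag-n05-d's re-keyed faces the N05 knit displays ONE printed member of [Balaban1985RegularSpaces] as a hypothesis, `p7 : B8SectGH.Prop7PrintedR
(famB8OfRecordSubB θ …) (fun j => λ.toAxial j.1)`, with `λ.toAxial` FREE (junk-dischargeable: g4's (K1)); ref-E's standing condition: «counts only
with `toAxial` pinned to print's map».  Brick 1 typed print's map `uTower` ∕ `toAxialTower` (the depth-`J` gauge fixing of [3] on each maximal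
listed tower of level `J`; well defined on the tree's cover indices because `L`-adic blocks through a common site are nested) and proved the
(1.19)-clause by pure algebra.  THIS FILE proves, at every member `i` of `zdGF3` with `Ω₀ = ℤᵈ` obeying NODE 00's located law №8, in the regime
`0 < α₀, α₂ ≤ c(d, L)` (r05 g7's `cst`) and for every datum with the carrier's (1.139) `InA α₀ U₀`, (1.140) `C140 α₂ U₀ P`:
* §3 `clampedStanding`: the pair CLAMPED from any box `[lo, hi] ⊂ Ω_J` (`B7Prop1Local.clampCfg`, and `clampFld` for the Lie-algebra field
  `B = iηA`, `A = mlogCfg` the canonical exponent) satisfies EVERY global standing hypothesis of r05 g7's `B8Prop7AdmittedFamily` §1∕§3 at depth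
  `J` — `sup_p|π*U₀(∂p) − 1| < 2α₀L^{−2J}` ((1.139) at level `J` on the box, `pdev_clampCfg_le`), `sup|π*B| ≤ ηα₂(Lᴶη)⁻¹` ((1.140)),
  `sup_p|π*(U′U₀)(∂p) − 1| < 2(α₀ + 3α₂)L^{−2J}` ((1.141) on the box: g4's `inAk_gaugeAct_of_c140` at `u = 1`), the Prop.-2∕Prop.-4 windows
  (`windows_of_cst` = r05 g7's private `standing` arithmetic, re-derived) — and agrees with `(U₀, U′)` on the box;
* §4 `uTower_facts`: `uTower x ∈ U(𝔸)` and `|uTower x − 1| ≤ 200d·α₂` at EVERY site (on the deepest listed tower `Bᴶ(y) ∋ x`: r05 g7's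
  `glev_mem_unitaryUnits` ∕ `norm_glev_sub_one_le` for the pair clamped from the tower, transported back by [3]'s locality
  `B8Ineq172Concrete.glev_congr_tower`); hence `inAAx_toAxialTower_of_laws` — THE WHOLE (1.144)-CLAUSE for print's map, unconditionally
  (brick 1's `inAAx_toAxialTower` with its unitarity premiss discharged);
* the SEQUEL `B8Prop7TowerAxialIneq145` (split at the 400-line bound): (1.145) in the box form with `530d` at every bond of every level
  (`avgClose_toAxialTower`, incl. the inter-tower bonds) and `B8Ineq145.Prop7RepairedC (530·d) (zdGF3 ∘ e) (toAxialTower ∘ e)`.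
WHAT THIS DOES NOT DO: it does not prove the TYPED conjunct `Prop7PrintedR` (constant `2`), does not re-type the leaf, does not choose the species.

## HONEST SCOPE

Kernel bookkeeping + by-name instantiation of landed theorems (`glev_mem_unitaryUnits`, `norm_glev_sub_one_le`, `norm_tildIter_sub_one_le`,
`avgIter(_mul)_mem_unitaryUnits`, `glev_congr_tower`, `avgIter_congr`, `clampCfg` lemmas, `inAk_gaugeAct_of_c140`); NO estimate of
[Balaban1985RegularSpaces] or [3] is proved anew — the constants `200d`, `130d`, `530d` and the threshold `c(d, L)` are r05 g7's, localised; the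
leaf is NOT re-typed and NO species is chosen here.  Count-neutral; N05 NOT discharged; `T_η ↦ ℤᵈ` carriers, `G = U(𝔸)`, `d ≥ 2`; one finite
`T⁴` programme at fixed `ε`, Bałaban as printed — nothing continuum ∕ ℝ⁴ ∕ OS ∕ mass-gap ∕ Clay.  No `sorry`, no `axiom`, no `instance`, no
`notation`.  Unit `pub-ymgap-dag-n05-c` (g6), 2026-08-27.

[cite: Balaban1985RegularSpaces, Prop. 7 (1.144) p.100, (1.139)–(1.141) p.100, (1.19) p.79, (1.5)–(1.6) p.77, p.81;
Balaban1985Averaging, (52)–(54) p.26, (76)–(77) pp.29–30, (87) p.31, p.24]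
-/

noncomputable section

open NormedSpace

namespace Literature.MathematicalPhysics.QuantumFieldTheory.Balaban1983to89.B8Prop7TowerAxialUnitary

open B7Prop1Explicit B7Prop2Explicit B7Prop1Local B7Eq92Concrete B7Eq84Concrete
open B7Prop2Explicit (C0 c2' unitaryUnits_le_U1)
open B7Prop3Flat (c3)
open B8Ineq130 (tlo thi)
open B8Ineq132 (InAk Under PlaqTouches BondTouches plaqF)
open B8Eq119TwistedAxial (InAx)
open B8Eq106Local (under_iff_tower)
open B8Eq140Level (SideTouches sideTouches_of_bondTouches)
open B8Eq146AExpansion (iEta expCfg norm_iEta_le)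
open B8Eq155JBound (expCfg_iEta_mem_unitaryUnits)
open B8Lemma1NonAbelian (mulCfg)
open B8Thm4Concrete (mulCfg_eq_mul)
open B8Prop7AdmittedFamily (cst cst_pos glev_mem_unitaryUnits norm_glev_sub_one_le norm_tildIter_sub_one_le avgIter_mem_unitaryUnits
  avgIter_mul_mem_unitaryUnits mgauge_mul_eq_gaugeAct_mulCfg)
open B7Prop8PrintedConstants (Rc_mem_unitaryUnits)
open B7AvgGaugeCovariance (uLev)
open B8Prop7GlevZd3 (c140_dictionary inAk_gaugeAct_of_c140)
open B8Ineq172Concrete (glev_congr_tower)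
open B8Prop7TowerAxialZd3 (Covered towerDepth uTower toAxialTower inTower_towerDepth towerDepth_le uTower_of_covered uTower_of_not_covered
  inAAx_toAxialTower)
open B8LeafModelZd (ZdIdx)
open B8LeafModelZd3 (zdGF3 mlogCfg)

-- `Site` alone could resolve to the torus sites of `Setup.lean`; re-export the `ℤ^d` sites of `B7Prop1Explicit`.
export B7Prop1Explicit (Site)

variable {d : ℕ}

/-! ## §1 Clamping a Lie-algebra field; the clamped pair; local suprema -/

section Clamp

variable {𝔸 : Type*} [NormedRing 𝔸] [NormedAlgebra ℂ 𝔸] [CompleteSpace 𝔸]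

/-- The clamped extension of an `𝔸`-valued bond field from the box `[lo, hi]` (values copied along the projection on genuine bonds, `0` on
degenerate ones) — the Lie-algebra twin of `B7Prop1Local.clampCfg`. [cite: Balaban1985Averaging, p.24 («this definition is local»; bookkeeping)] -/
def clampFld (lo hi : Site d) (B : Site d → Fin d → 𝔸) : Site d → Fin d → 𝔸 := fun x κ =>
  if lo κ ≤ x κ ∧ x κ < hi κ then B (clamp lo hi x) κ else 0

/-- `e^{π*B} = π*(e^{B})`: clamping commutes with the pointwise exponential (`e⁰ = 1` on the degenerate bonds). [cite: Balaban1985Averaging, p.24 (bookkeeping)] -/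
theorem expCfg_clampFld (lo hi : Site d) (B : Site d → Fin d → 𝔸) : expCfg (clampFld lo hi B) = clampCfg lo hi (expCfg B) := by
  funext x κ
  simp only [expCfg, clampFld, clampCfg]
  split_ifs
  · rfl
  · exact B7Prop8Flat.expUnit_zero

omit [NormedAlgebra ℂ 𝔸] [CompleteSpace 𝔸] in
/-- The clamped field is bounded by the field's bound ON THE BOX. [cite: Balaban1985Averaging, p.24 (bookkeeping)] -/
theorem norm_clampFld_le {lo hi : Site d} (hlohi : ∀ i, lo i ≤ hi i) {B : Site d → Fin d → 𝔸} {b : ℝ} (hb : 0 ≤ b)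
    (hB : ∀ x κ, InBox lo hi x → ‖B x κ‖ ≤ b) (x : Site d) (κ : Fin d) : ‖clampFld lo hi B x κ‖ ≤ b := by
  simp only [clampFld]
  split_ifs
  · exact hB _ κ (clamp_inBox hlohi x)
  · rw [norm_zero]; exact hb

omit [NormedAlgebra ℂ 𝔸] [CompleteSpace 𝔸] in
/-- Clamping is multiplicative: `π*(V·W) = π*V · π*W` (pointwise products of bond fields). [cite: Balaban1985Averaging, p.24 (bookkeeping)] -/
theorem clampCfg_mul (lo hi : Site d) (V W : Site d → Fin d → 𝔸ˣ) : clampCfg lo hi (V * W) = clampCfg lo hi V * clampCfg lo hi W := by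
  funext x κ
  simp only [clampCfg, Pi.mul_apply]
  split_ifs
  · rfl
  · rw [mul_one]

omit [NormedAlgebra ℂ 𝔸] [CompleteSpace 𝔸] in
/-- The local plaquette supremum from a pointwise bound on the plaquettes INSIDE the box (`b ≥ 0`; degenerate plaquettes contribute `0`).
[cite: Balaban1985Averaging, (52) p.26 (bookkeeping)] -/
theorem pdevOn_le_of_forall {lo hi : Site d} {V : Site d → Fin d → 𝔸ˣ} {b : ℝ} (hb : 0 ≤ b)
    (h : ∀ (x : Site d) (μ ν : Fin d), μ ≠ ν → PlaqIn lo hi (x, μ, ν) → ‖plaqF V μ ν x - 1‖ ≤ b) : pdevOn lo hi V ≤ b := by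
  refine Real.iSup_le (fun p => ?_) hb
  obtain ⟨⟨x, μ, ν⟩, hp⟩ := p
  rcases eq_or_ne μ ν with rfl | hμν
  · show ‖((hol V x (plaqWord μ μ) : 𝔸ˣ) : 𝔸) - 1‖ ≤ b
    rw [hol_plaqWord_self, Units.val_one, sub_self, norm_zero]; exact hb
  · exact h x μ ν hμν hp

end Clamp

/-! ## §2 The numerical windows of r05 g7's standing data from `α₀, α₂ ≤ c(d, L)` (re-derived; `B8Prop7AdmittedFamily.standing` is private) -/

section Windows

/-- What `α ≤ c(d, L)` gives (the seven windows of `B8Prop7AdmittedFamily.cst`). [cite: Balaban1985RegularSpaces, Prop. 7 p.100 («for α₀, α₂ sufficiently small»)] -/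
theorem cst_le {L : ℕ} {α : ℝ} (hαc : α ≤ cst d L) :
    α ≤ 1 / (80 * (d : ℝ)) ∧ α ≤ 1 / (24 * C0 d) ∧ α ≤ c2' d L / 16 ∧
      α ≤ 1 / (32000 * ((d : ℝ) + 1) ^ 2 * ((d : ℝ) + 4)) ∧ α ≤ 1 / (2097152 * ((d : ℝ) + 1) ^ 2) ∧
        α ≤ c3 d L / 2 ∧ α ≤ 1 / (2048 * (d : ℝ)) := by
  unfold cst at hαc
  simp only [le_min_iff] at hαc
  obtain ⟨h1, h2, h3, h4, h5, h6, h7⟩ := hαc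
  exact ⟨h1, h2, h3, h4, h5, h6, h7⟩

/-- `Real.exp (1/5) · (3/2) ≤ 2` (private arithmetic). [folklore] -/
private theorem exp_fifth_mul_le : Real.exp (1 / 5) * (1 + 1 / 2) ≤ 2 := by
  have := B7Eq31BCH.exp_one_fifth_le
  nlinarith [Real.exp_pos (1 / 5 : ℝ)]

/-- **The Prop.-2 ∕ Prop.-4 windows of [3] at depth `J`** for `α₀′ = 2α₀`, `α_P = 2(α₀ + 3α₂)` and the scale `b = ηα₂(Lᴶη)⁻¹` (`Lᴶb = α₂`),
from `0 < α₀, α₂ ≤ c(d, L)` — r05 g7's standing arithmetic, verbatim. [cite: Balaban1985RegularSpaces, Prop. 7 p.100 («for α₀, α₂ sufficiently small»); Balaban1985Averaging, (52)–(54) p.26] -/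
theorem windows_of_cst (hd : 1 ≤ d) {L : ℕ} (hL1 : 1 ≤ L) (J : ℕ) {η : ℝ} (hη : 0 < η)
    {α₀ α₂ : ℝ} (hα₀ : 0 < α₀) (hα₀c : α₀ ≤ cst d L) (hα₂ : 0 < α₂) (hα₂c : α₂ ≤ cst d L) :
    (L : ℝ) ^ J * (η * (α₂ * ((L : ℝ) ^ J * η)⁻¹)) = α₂ ∧ 0 ≤ η * (α₂ * ((L : ℝ) ^ J * η)⁻¹) ∧
    0 < 2 * α₀ ∧ C0 d * (2 * α₀) ≤ 1 / 3 ∧ 4 * (2 * α₀) ≤ c2' d L ∧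
    Real.exp (4 * (800 * ((d : ℝ) + 1) ^ 2 * ((d : ℝ) + 4)) * (2 * α₀))
      * (1 + 8 * (131072 * ((d : ℝ) + 1) ^ 2) * ((L : ℝ) ^ J * (η * (α₂ * ((L : ℝ) ^ J * η)⁻¹)))) ≤ 2 ∧
    2 * ((L : ℝ) ^ J * (η * (α₂ * ((L : ℝ) ^ J * η)⁻¹))) ≤ c3 d L ∧
    2048 * (d : ℝ) * ((L : ℝ) ^ J * (η * (α₂ * ((L : ℝ) ^ J * η)⁻¹))) ≤ 1 ∧
    0 < 2 * (α₀ + 3 * α₂) ∧ C0 d * (2 * (α₀ + 3 * α₂)) ≤ 1 / 3 ∧ 2 * (2 * (α₀ + 3 * α₂)) ≤ c2' d L ∧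
    α₀ ≤ 1 / (80 * (d : ℝ)) ∧ α₂ ≤ 1 / (80 * (d : ℝ)) := by
  obtain ⟨h80₀, h24₀, hc2₀, h32₀, -, -, -⟩ := cst_le hα₀c
  obtain ⟨h80₂, h24₂, hc2₂, -, h21₂, hc3₂, h2048₂⟩ := cst_le hα₂c
  have hC0 := C0_pos d
  have hL0 : (L : ℝ) ≠ 0 := by
    have : (0 : ℝ) < L := by exact_mod_cast (lt_of_lt_of_le (by norm_num) hL1)
    exact this.ne'
  have hη0 : η ≠ 0 := hη.ne'
  set b : ℝ := η * (α₂ * ((L : ℝ) ^ J * η)⁻¹) with hbdef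
  have hscale : (L : ℝ) ^ J * b = α₂ := by rw [hbdef]; field_simp
  have hb : 0 ≤ b := by positivity
  have e24 : C0 d * (1 / (24 * C0 d)) = 1 / 24 := by field_simp
  have hC₀ : C0 d * α₀ ≤ 1 / 24 := (mul_le_mul_of_nonneg_left h24₀ hC0.le).trans_eq e24
  have hC₂ : C0 d * α₂ ≤ 1 / 24 := (mul_le_mul_of_nonneg_left h24₂ hC0.le).trans_eq e24
  have hsmall : Real.exp (4 * (800 * ((d : ℝ) + 1) ^ 2 * ((d : ℝ) + 4)) * (2 * α₀))
      * (1 + 8 * (131072 * ((d : ℝ) + 1) ^ 2) * ((L : ℝ) ^ J * b)) ≤ 2 := by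
    rw [hscale]
    have e5 : (6400 * (((d : ℝ) + 1) ^ 2 * ((d : ℝ) + 4))) * (1 / (32000 * ((d : ℝ) + 1) ^ 2 * ((d : ℝ) + 4)))
        = 1 / 5 := by
      field_simp; ring
    have hx : 4 * (800 * ((d : ℝ) + 1) ^ 2 * ((d : ℝ) + 4)) * (2 * α₀) ≤ 1 / 5 := by
      have h := (mul_le_mul_of_nonneg_left h32₀ (by positivity :
        (0 : ℝ) ≤ 6400 * (((d : ℝ) + 1) ^ 2 * ((d : ℝ) + 4)))).trans_eq e5
      have : 4 * (800 * ((d : ℝ) + 1) ^ 2 * ((d : ℝ) + 4)) * (2 * α₀)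
          = (6400 * (((d : ℝ) + 1) ^ 2 * ((d : ℝ) + 4))) * α₀ := by ring
      rw [this]; exact h
    have e2 : (1048576 * ((d : ℝ) + 1) ^ 2) * (1 / (2097152 * ((d : ℝ) + 1) ^ 2)) = 1 / 2 := by
      field_simp; ring
    have hy : 8 * (131072 * ((d : ℝ) + 1) ^ 2) * α₂ ≤ 1 / 2 := by
      have h := (mul_le_mul_of_nonneg_left h21₂ (by positivity : (0 : ℝ) ≤ 1048576 * ((d : ℝ) + 1) ^ 2)).trans_eq e2
      have : 8 * (131072 * ((d : ℝ) + 1) ^ 2) * α₂ = (1048576 * ((d : ℝ) + 1) ^ 2) * α₂ := by ring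
      rw [this]; exact h
    have hy0 : 0 ≤ 8 * (131072 * ((d : ℝ) + 1) ^ 2) * α₂ := by positivity
    calc _ ≤ Real.exp (1 / 5) * (1 + 1 / 2) := by
          gcongr
      _ ≤ 2 := exp_fifth_mul_le
  have hc₃ : 2 * ((L : ℝ) ^ J * b) ≤ c3 d L := by rw [hscale]; linarith
  have hsm : 2048 * (d : ℝ) * ((L : ℝ) ^ J * b) ≤ 1 := by
    rw [hscale]
    have hd0 : (0 : ℝ) < d := by exact_mod_cast hd
    have e1 : (2048 * (d : ℝ)) * (1 / (2048 * (d : ℝ))) = 1 := by field_simp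
    exact (mul_le_mul_of_nonneg_left h2048₂ (by positivity : (0 : ℝ) ≤ 2048 * (d : ℝ))).trans_eq e1
  exact ⟨hscale, hb, by positivity, by linarith, by linarith, hsmall, hc₃, hsm, by positivity, by linarith, by linarith, h80₀, h80₂⟩

end Windows

/-! ## §3 The CLAMPED STANDING DATA of a box inside `Ω_J`: r05 g7's global hypotheses hold for the pair clamped from the box -/

section Standing

variable {𝔸 : Type} [CStarAlgebra 𝔸] [Nontrivial 𝔸] {L : ℕ} {β : ℝ} {len : Site d → ℝ}

omit [Nontrivial 𝔸] in
/-- Agreement on a box is multiplicative (pointwise products of bond fields). [cite: Balaban1985Averaging, p.24 (bookkeeping)] -/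
theorem agreeOn_mul {lo hi : Site d} {V V' W W' : Site d → Fin d → 𝔸ˣ} (hV : AgreeOn lo hi V V') (hW : AgreeOn lo hi W W') :
    AgreeOn lo hi (V * W) (V' * W') := fun x κ hx hxe => by
  show V x κ * W x κ = V' x κ * W' x κ
  rw [hV x κ hx hxe, hW x κ hx hxe]

/-- **THE CLAMPED STANDING DATA** (print p. 100 «we can apply the results of [3]», [3] p. 24 locality): at a member of `zdGF3` with `Ω₀ = ℤᵈ`
(`d, L ≥ 2`), the carrier's (1.139) `InA α₀ U₀` and (1.140) `C140 α₂ U₀ P` with `0 < α₀, α₂ ≤ c(d, L)`, a level `J ≤ k` and a box `[lo, hi] ⊂ Ω_J`: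
the pair CLAMPED from the box — `π*U₀` and `e^{π*B}`, `B = iηA`, `A` the canonical exponent of `U′` — satisfies EVERY standing hypothesis of
lit-balaban r05 g7's `B8Prop7AdmittedFamily` §1∕§3 at depth `J` (unitarity; `sup_p|π*U₀(∂p) − 1| < 2α₀L^{−2J}`; `sup|π*B| ≤ b`, `Lᴶb = α₂`; the
Prop.-2∕Prop.-4 windows; `sup_p|π*(U′U₀)(∂p) − 1| < 2(α₀ + 3α₂)L^{−2J}` from (1.141)), and AGREES with `(U₀, U′)` on the box.  Listed in the
argument order of `glev_mem_unitaryUnits` ∕ `norm_glev_sub_one_le` ∕ `norm_tildIter_sub_one_le`, then `Lᴶb = α₂` and the two agreements.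
[cite: Balaban1985RegularSpaces, (1.139)–(1.141) p.100; Balaban1985Averaging, (52)–(54) p.26, p.24] -/
theorem clampedStanding (hd2 : 2 ≤ d) (hL : 2 ≤ L) (i : ZdIdx d L) (hΩ0 : i.Ω 0 = Set.univ)
    {α₀ α₂ : ℝ} (hα₀ : 0 < α₀) (hα₀c : α₀ ≤ cst d L) (hα₂ : 0 < α₂) (hα₂c : α₂ ≤ cst d L)
    (U₀ : (zdGF3 𝔸 L β len i).Cfg) (P : (zdGF3 𝔸 L β len i).Pert)
    (hInA : (zdGF3 𝔸 L β len i).InA α₀ U₀) (h140 : (zdGF3 𝔸 L β len i).C140 α₂ U₀ P)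
    {J : ℕ} (hJ : J ≤ i.k) {lo hi : Site d} (hlohi : ∀ i', lo i' ≤ hi i') (hboxΩ : ∀ z, InBox lo hi z → z ∈ i.Ω J) :
    (∀ z κ, clampCfg lo hi U₀.1 z κ ∈ unitaryUnits 𝔸) ∧
    (∀ z κ, expCfg (clampFld lo hi (iEta i.η (mlogCfg i.k i.η i.Ω P.2.1))) z κ ∈ unitaryUnits 𝔸) ∧
    0 < 2 * α₀ ∧ C0 d * (2 * α₀) ≤ 1 / 3 ∧ 4 * (2 * α₀) ≤ c2' d L ∧
    pdev (clampCfg lo hi U₀.1) < 2 * α₀ * (((L : ℝ) ^ J)⁻¹) ^ 2 ∧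
    0 ≤ i.η * (α₂ * ((L : ℝ) ^ J * i.η)⁻¹) ∧
    (∀ z κ, ‖clampFld lo hi (iEta i.η (mlogCfg i.k i.η i.Ω P.2.1)) z κ‖ ≤ i.η * (α₂ * ((L : ℝ) ^ J * i.η)⁻¹)) ∧
    Real.exp (4 * (800 * ((d : ℝ) + 1) ^ 2 * ((d : ℝ) + 4)) * (2 * α₀))
      * (1 + 8 * (131072 * ((d : ℝ) + 1) ^ 2) * ((L : ℝ) ^ J * (i.η * (α₂ * ((L : ℝ) ^ J * i.η)⁻¹)))) ≤ 2 ∧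
    2 * ((L : ℝ) ^ J * (i.η * (α₂ * ((L : ℝ) ^ J * i.η)⁻¹))) ≤ c3 d L ∧
    2048 * (d : ℝ) * ((L : ℝ) ^ J * (i.η * (α₂ * ((L : ℝ) ^ J * i.η)⁻¹))) ≤ 1 ∧
    0 < 2 * (α₀ + 3 * α₂) ∧ C0 d * (2 * (α₀ + 3 * α₂)) ≤ 1 / 3 ∧ 2 * (2 * (α₀ + 3 * α₂)) ≤ c2' d L ∧
    pdev (expCfg (clampFld lo hi (iEta i.η (mlogCfg i.k i.η i.Ω P.2.1))) * clampCfg lo hi U₀.1)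
      < 2 * (α₀ + 3 * α₂) * (((L : ℝ) ^ J)⁻¹) ^ 2 ∧
    (L : ℝ) ^ J * (i.η * (α₂ * ((L : ℝ) ^ J * i.η)⁻¹)) = α₂ ∧
    AgreeOn lo hi U₀.1 (clampCfg lo hi U₀.1) ∧
    AgreeOn lo hi P.2.1 (expCfg (clampFld lo hi (iEta i.η (mlogCfg i.k i.η i.Ω P.2.1)))) := by
  have hL1 : 1 ≤ L := le_trans one_le_two hL
  have hd : 1 ≤ d := le_trans one_le_two hd2
  -- the dictionary: `U′ = e^{iηA}`, `A` Hermitian, (1.140) level by level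
  obtain ⟨hAh, hU₁, hC⟩ := c140_dictionary hd2 hL1 i hΩ0 U₀ P h140
  set A := mlogCfg i.k i.η i.Ω P.2.1 with hA_def
  -- the windows
  obtain ⟨hscale, hb, hα', hα3', hα4', hsmall, hc₃, hsm, hαP, hαP3, hαP2, h80₀, h80₂⟩ :=
    windows_of_cst hd hL1 J i.hη hα₀ hα₀c hα₂ hα₂c
  set b : ℝ := i.η * (α₂ * ((L : ℝ) ^ J * i.η)⁻¹) with hb_def
  -- the clamped pair
  set U₀c := clampCfg lo hi U₀.1 with hU₀c
  set Bc := clampFld lo hi (iEta i.η A) with hBc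
  have hU₀cu : ∀ z κ, U₀c z κ ∈ unitaryUnits 𝔸 := fun z κ => clampCfg_mem U₀.2 z κ
  have hBcu : ∀ z κ, expCfg Bc z κ ∈ unitaryUnits 𝔸 := fun z κ => by
    rw [hBc, expCfg_clampFld]
    exact clampCfg_mem (expCfg_iEta_mem_unitaryUnits i.η hAh) z κ
  -- `sup |π*B| ≤ b` from (1.140) at level `J` on the box
  have hAbox : ∀ z κ, InBox lo hi z → ‖iEta i.η A z κ‖ ≤ b := by
    intro z κ hz
    haveI : Nontrivial (Fin d) := Fin.nontrivial_iff_two_le.mpr hd2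
    obtain ⟨κ', hκ'⟩ := exists_ne κ
    have hst : SideTouches (i.Ω J) z κ := sideTouches_of_bondTouches hκ' (Or.inl (hboxΩ z hz))
    have h1 : ‖A z κ‖ ≤ α₂ * ((L : ℝ) ^ J * i.η)⁻¹ := ((hC J hJ).1 z κ hst).le
    exact norm_iEta_le (A := fun _ _ => A z κ) i.hη.le (fun _ _ => h1) z κ
  have hBcn : ∀ z κ, ‖Bc z κ‖ ≤ b := norm_clampFld_le hlohi hb hAbox
  -- `sup_p |π*U₀(∂p) − 1| ≤ α₀L^{−2J} < 2α₀L^{−2J}` from (1.139) at level `J` on the box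
  have hLJ : (0 : ℝ) < (((L : ℝ) ^ J)⁻¹) ^ 2 := by
    have hL0 : (0 : ℝ) < L := by exact_mod_cast lt_of_lt_of_le Nat.zero_lt_one hL1
    positivity
  have h52 : pdev U₀c < 2 * α₀ * (((L : ℝ) ^ J)⁻¹) ^ 2 := by
    have hle : pdevOn lo hi U₀.1 ≤ α₀ * (((L : ℝ) ^ J)⁻¹) ^ 2 :=
      pdevOn_le_of_forall (by positivity) fun z μ ν hμν hp => ((hInA J hJ).1 z μ ν hμν (Or.inl (hboxΩ z hp.1))).le
    have h := pdev_clampCfg_le hlohi (fun z κ => unitaryUnits_le_U1 (U₀.2 z κ))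
    rw [← hU₀c] at h
    nlinarith
  -- `sup_p |π*(U₁U₀)(∂p) − 1| ≤ (α₀ + 3α₂)L^{−2J}` from (1.141) on the box (`inAk_gaugeAct_of_c140` at `u = 1`)
  have h141 : InAk L i.k i.η (α₀ + 3 * α₂) i.Ω (mulCfg P.2.1 U₀.1) := by
    have h := inAk_gaugeAct_of_c140 hd2 hL1 i hΩ0 hα₀ h80₀ hα₂ h80₂ U₀ P hInA h140
      (u := 1) (fun _ => (unitaryUnits 𝔸).one_mem)
    rwa [B8Ineq130.gaugeAct_one] at h
  have hP : pdev (expCfg Bc * U₀c) < 2 * (α₀ + 3 * α₂) * (((L : ℝ) ^ J)⁻¹) ^ 2 := by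
    have hle : pdevOn lo hi (P.2.1 * U₀.1) ≤ (α₀ + 3 * α₂) * (((L : ℝ) ^ J)⁻¹) ^ 2 := by
      refine pdevOn_le_of_forall (by positivity) fun z μ ν hμν hp => ?_
      have h := (h141 J hJ).1 z μ ν hμν (Or.inl (hboxΩ z hp.1))
      rw [mulCfg_eq_mul] at h
      exact h.le
    have hprod : expCfg Bc * U₀c = clampCfg lo hi (P.2.1 * U₀.1) := by
      rw [hBc, expCfg_clampFld, hU₀c, ← clampCfg_mul, ← hU₁]
    have hPu : ∀ z κ, (P.2.1 * U₀.1) z κ ∈ U1 𝔸 := fun z κ => by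
      rw [Pi.mul_apply]
      exact unitaryUnits_le_U1 ((unitaryUnits 𝔸).mul_mem (P.2.2 z κ) (U₀.2 z κ))
    have h := pdev_clampCfg_le hlohi hPu
    rw [← hprod] at h
    have : 0 < (α₀ + 3 * α₂) * (((L : ℝ) ^ J)⁻¹) ^ 2 := by positivity
    linarith
  have h₀ : AgreeOn lo hi U₀.1 U₀c := (clampCfg_agree U₀.1).symm
  have h₁ : AgreeOn lo hi P.2.1 (expCfg Bc) := by
    rw [hBc, expCfg_clampFld, ← hU₁]
    exact (clampCfg_agree P.2.1).symm
  exact ⟨hU₀cu, hBcu, hα', hα3', hα4', h52, hb, hBcn, hsmall, hc₃, hsm, hαP, hαP3, hαP2, hP, hscale, h₀, h₁⟩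

end Standing

/-! ## §4 `uTower` is `U(𝔸)`-valued and within `200d·α₂` of `1`; the (1.144)-clause for print's map, unconditionally -/

section Unitary

variable {𝔸 : Type} [CStarAlgebra 𝔸] [Nontrivial 𝔸] {L : ℕ} {β : ℝ} {len : Site d → ℝ}

/-- **[3]'s GAUGE FIXING OF DEPTH `J` ON A TOWER `Bᴶ(y) ⊂ Ω_J` IS UNITARY-VALUED AND WITHIN `200d·α₂` OF `1`, from the LOCAL hypotheses (1.139) ∕
(1.140)** (r05 g7's `glev_mem_unitaryUnits` ∕ `norm_glev_sub_one_le` for the clamped pair, transported back by `glev_congr_tower`).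
[cite: Balaban1985RegularSpaces, (1.139)–(1.141) p.100, p.81; Balaban1985Averaging, (76)–(77) pp.29–30, (87) p.31, (163) p.42, p.24] -/
theorem glev_facts_of_tower (hd2 : 2 ≤ d) (hL : 2 ≤ L) (i : ZdIdx d L) (hΩ0 : i.Ω 0 = Set.univ)
    {α₀ α₂ : ℝ} (hα₀ : 0 < α₀) (hα₀c : α₀ ≤ cst d L) (hα₂ : 0 < α₂) (hα₂c : α₂ ≤ cst d L)
    (U₀ : (zdGF3 𝔸 L β len i).Cfg) (P : (zdGF3 𝔸 L β len i).Pert)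
    (hInA : (zdGF3 𝔸 L β len i).InA α₀ U₀) (h140 : (zdGF3 𝔸 L β len i).C140 α₂ U₀ P)
    {J : ℕ} (hJ : J ≤ i.k) {y : Site d} (hyΩ : ∀ x, Under L J y x → x ∈ i.Ω J) {x : Site d} (hx : Under L J y x) :
    glev L (le_trans one_le_two hL) U₀.1 P.2.1 J 0 x ∈ unitaryUnits 𝔸 ∧
      ‖((glev L (le_trans one_le_two hL) U₀.1 P.2.1 J 0 x : 𝔸ˣ) : 𝔸) - 1‖ ≤ 200 * (d : ℝ) * α₂ := by
  have hL1 : 1 ≤ L := le_trans one_le_two hL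
  have hd : 1 ≤ d := le_trans one_le_two hd2
  obtain ⟨hxlo, hxhi⟩ := (under_iff_tower L J y x).1 hx
  have hlohi : ∀ i', tlo L y J i' ≤ thi L y J i' := fun i' => (hxlo i').trans (hxhi i')
  have hboxΩ : ∀ z, InBox (tlo L y J) (thi L y J) z → z ∈ i.Ω J := fun z hz =>
    hyΩ z ((under_iff_tower L J y z).2 ⟨fun i' => (hz i').1, fun i' => (hz i').2⟩)
  obtain ⟨hU₀cu, hBcu, hα', hα3', hα4', h52, hb, hBcn, hsmall, hc₃, hsm, hαP, hαP3, hαP2, hP, hscale, h₀, h₁⟩ :=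
    clampedStanding hd2 hL i hΩ0 hα₀ hα₀c hα₂ hα₂c U₀ P hInA h140 hJ hlohi hboxΩ
  rw [glev_congr_tower hL1 h₀ h₁ J 0 (by omega) x hxlo hxhi]
  refine ⟨glev_mem_unitaryUnits hd hL hU₀cu hBcu hα' hα3' hα4' h52 hb hBcn hsmall hc₃ hsm hαP hαP3 hαP2 hP hL1 0 (Nat.zero_le _) x, ?_⟩
  have h := norm_glev_sub_one_le hd hL hU₀cu hBcu hα' hα3' hα4' h52 hb hBcn hsmall hc₃ hsm hαP hαP3 hαP2 hP hL1 0 (Nat.zero_le _) x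
  rwa [hscale] at h

/-- **PRINT'S TOWER-WISE MAP IS `U(𝔸)`-VALUED AND WITHIN `200d·α₂` OF `1` IN PROPOSITION 7's REGIME** at a member of `zdGF3` with `Ω₀ = ℤᵈ`
(`d, L ≥ 2`; towers in their domains by `ZdIdx.htower`, every site covered by `ZdIdx.hpart`): from (1.139) ∕ (1.140) with `0 < α₀, α₂ ≤ c(d, L)`.
[cite: Balaban1985RegularSpaces, Prop. 7 p.100, (1.139)–(1.141) p.100, p.81, (1.6) p.77; Balaban1985Averaging, (76)–(77) pp.29–30, (87) p.31, (163) p.42] -/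
theorem uTower_facts (hd2 : 2 ≤ d) (hL : 2 ≤ L) (i : ZdIdx d L) (hΩ0 : i.Ω 0 = Set.univ)
    {α₀ α₂ : ℝ} (hα₀ : 0 < α₀) (hα₀c : α₀ ≤ cst d L) (hα₂ : 0 < α₂) (hα₂c : α₂ ≤ cst d L)
    (U₀ : (zdGF3 𝔸 L β len i).Cfg) (P : (zdGF3 𝔸 L β len i).Pert)
    (hInA : (zdGF3 𝔸 L β len i).InA α₀ U₀) (h140 : (zdGF3 𝔸 L β len i).C140 α₂ U₀ P) (x : Site d) :
    uTower L (le_trans one_le_two hL) i.k (i.Λs i.k) U₀.1 P.2.1 x ∈ unitaryUnits 𝔸 ∧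
      ‖((uTower L (le_trans one_le_two hL) i.k (i.Λs i.k) U₀.1 P.2.1 x : 𝔸ˣ) : 𝔸) - 1‖ ≤ 200 * (d : ℝ) * α₂ := by
  -- every site is covered (`Ω₀ = ℤᵈ`, (1.6))
  have hc : Covered L i.k (i.Λs i.k) x := by
    obtain ⟨j, hj, y, hy, hxy⟩ := i.hpart x (by rw [hΩ0]; exact Set.mem_univ x)
    exact ⟨j, hj, y, hy, (under_iff_tower L j y x).2 ⟨fun i' => (hxy i').1, fun i' => (hxy i').2⟩⟩
  rw [uTower_of_covered hc]
  obtain ⟨y, hy, hyx⟩ := inTower_towerDepth hc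
  refine glev_facts_of_tower hd2 hL i hΩ0 hα₀ hα₀c hα₂ hα₂c U₀ P hInA h140 (towerDepth_le x) (y := y) ?_ hyx
  intro z hz
  obtain ⟨h1, h2⟩ := (under_iff_tower L _ y z).1 hz
  exact i.htower _ (towerDepth_le x) y hy z fun i' => ⟨h1 i', h2 i'⟩

/-- **THE WHOLE (1.144)-CLAUSE OF PROPOSITION 7's CONCLUSION FOR PRINT'S MAP, UNCONDITIONALLY**: at a member of `zdGF3` with `Ω₀ = ℤᵈ` obeying NODE
00's located index law №8 (`trunc_lt` ∕ `trunc_top` VERBATIM), for `0 < α₀, α₂ ≤ c(d, L)` and every datum with (1.139) ∕ (1.140),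
`(zdGF3 …).InAAx (α₀ + 3α₂) U₀ (toAxialTower … U₀ P)` — «U′U₀ = (U₁U₀)^{u} ∈ 𝔄_k({Ω_j}, α₀ + 3α₂) ∩ Ax_m(𝔅_m, U₀) at every truncation», `u`
print's tower-wise gauge fixing (brick 1's `inAAx_toAxialTower`, unitarity premiss discharged by `uTower_facts`).
[cite: Balaban1985RegularSpaces, Prop. 7 (1.144) p.100, (1.139)–(1.140) p.100, (1.34) p.82, (1.19) p.79] -/
theorem inAAx_toAxialTower_of_laws (hd2 : 2 ≤ d) (hL : 2 ≤ L) (i : ZdIdx d L) (hΩ0 : i.Ω 0 = Set.univ)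
    (hlt : ∀ m, m < i.k → ∀ j, j < m → i.Λs m j = i.Λs (m + 1) j)
    (htop : ∀ m, m < i.k → ∀ x, x ∈ i.Λs m m ↔ x ∈ i.Λs (m + 1) m ∨ ∃ y ∈ i.Λs (m + 1) (m + 1),
      x ∈ Literature.MathematicalPhysics.QuantumLattice.blockSites L y)
    {α₀ α₂ : ℝ} (hα₀ : 0 < α₀) (hα₀c : α₀ ≤ cst d L) (hα₂ : 0 < α₂) (hα₂c : α₂ ≤ cst d L)
    (U₀ : (zdGF3 𝔸 L β len i).Cfg) (P : (zdGF3 𝔸 L β len i).Pert)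
    (hInA : (zdGF3 𝔸 L β len i).InA α₀ U₀) (h140 : (zdGF3 𝔸 L β len i).C140 α₂ U₀ P) :
    (zdGF3 𝔸 L β len i).InAAx (α₀ + 3 * α₂) U₀ (toAxialTower 𝔸 L β len (le_trans one_le_two hL) i U₀ P) := by
  obtain ⟨h80₀, -, -, -, -, -, -⟩ := cst_le (d := d) hα₀c
  obtain ⟨h80₂, -, -, -, -, -, -⟩ := cst_le (d := d) hα₂c
  exact inAAx_toAxialTower hd2 (le_trans one_le_two hL) i hΩ0 hlt htop hα₀ h80₀ hα₂ h80₂ U₀ P hInA h140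
    fun x => (uTower_facts hd2 hL i hΩ0 hα₀ hα₀c hα₂ hα₂c U₀ P hInA h140 x).1

end Unitary

end Literature.MathematicalPhysics.QuantumFieldTheory.Balaban1983to89.B8Prop7TowerAxialUnitary

end
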